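import Summits.CriticalPhenomena.PercolationContinuityZ3.Theorems.SahiCISMonotoneImageCI
import Literature.Probability.LatticeModels.CMTP2DensityFree

/-!
# CIS does not imply Fuchs–Wang's density-free cMTP₂ (5.1): a six-atom law on `[0,1]²`

Support file of the Sahi cell (`prim-sahi`, typer seat, generation 18; `--supports stmt-CriticalPhenomena-4575`).
Definitions of the example + theorems; no named facts, no sorries.

[FuchsWang2026] Thm. 2.8 (1): `cMTP₂(X_B|X_A) ⇒ SI(X_B|X_A)`, "the reverse direction does not hold, in general" (for the
density notion, by [17, Ex. 3.5]).  Density-free and kernel-checked: the law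

  `μ = (10 δ_(0,0) + 2 δ_(0,½) + 8 δ_(0,1) + 9 δ_(1,0) + δ_(1,½) + 10 δ_(1,1)) / 40`   on `[0,1]²`

is CIS in the a.e.-kernel sense (`isCISae_cexLaw`: `P(X₂ ≤ t | X₁)` decreases in `X₁`: `.45 ≤ .5`, `.5 ≤ .6`; checked by
`decide` through `SahiCISAtomicDecide`), but violates (5.1) for the split `({1},{2})` (`not_isCMTP2Set_cexLaw`: with
`C = {1}`, `D = {0}`, `x = 0`, `y = ½`: `μ(C×[0,0]) μ(D×[0,½]) = 9·12/40² > 10·10/40² = μ((C∧D)×[0,0]) μ((C∨D)×[0,½])`).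
The obstruction is exactly the one the density notion sees: (5.1) with `|A| = 1` asks the RATIO
`P(X₂ ≤ x | X₁ = s)/P(X₂ ≤ y | X₁ = s)` (`x ≤ y`) to decrease in `s` (tp₂ in `(s, x)`), not just each conditional cdf.

No sorries, no new axioms.
-/

noncomputable section

namespace Summit.CriticalPhenomena.PercolationContinuityZ3.Theorems.SahiCMTP2

open MeasureTheory Set Function
open Literature.Probability.LatticeModels
open Summit.CriticalPhenomena.PercolationContinuityZ3.Theorems.SahiBoxTP2
open Summit.CriticalPhenomena.PercolationContinuityZ3.Theorems.SahiCIS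
open scoped ENNReal unitInterval SetFamily

/-- The codes of the six atoms `(0,0), (0,½), (0,1), (1,0), (1,½), (1,1)` (values `codeVal = (0, ½, 1)`). [this work] -/
def cexCodes : Fin 6 → Fin 2 → Fin 3 := ![![0, 0], ![0, 1], ![0, 2], ![2, 0], ![2, 1], ![2, 2]]

/-- The weights `10, 2, 8, 9, 1, 10` (total `40`). [this work] -/
def cexWeights : Fin 6 → ℕ := ![10, 2, 8, 9, 1, 10]

/-- The total weight is `40`. [this work] -/
theorem sum_cexWeights : (∑ k, cexWeights k) = 40 := by decide

/-- **The example**: `(10 δ_(0,0) + 2 δ_(0,½) + 8 δ_(0,1) + 9 δ_(1,0) + δ_(1,½) + 10 δ_(1,1)) / 40` on `[0,1]²`.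
[this work] -/
def cexLaw : Measure (Fin 2 → I) := (40 : ℝ≥0∞)⁻¹ • codedLaw codeVal cexCodes cexWeights

/-- It is a probability measure. [this work] -/
instance isProbabilityMeasure_cexLaw : IsProbabilityMeasure cexLaw :=
  ⟨by
    rw [cexLaw, Measure.smul_apply, smul_eq_mul, codedLaw_univ, sum_cexWeights]
    exact ENNReal.inv_mul_cancel (by norm_num) (by norm_num)⟩

/-- **The example is CIS** in the a.e.-kernel sense (kernel computation of the atom condition). [this work] -/
theorem isCISae_cexLaw : IsCISae 2 cexLaw := by
  haveI : IsProbabilityMeasure ((40 : ℝ≥0∞)⁻¹ • codedLaw codeVal cexCodes cexWeights) := isProbabilityMeasure_cexLaw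
  exact (isCISae_smul_codedLaw_iff strictMono_codeVal _ _ (by norm_num) (by norm_num)).2 (by decide)

/-- The four masses entering the violated instance of (5.1). [this work] -/
theorem cisMassLE_cex :
    cisMassLE cexCodes cexWeights ![2] 0 = 9 ∧ cisMassLE cexCodes cexWeights ![0] 1 = 12 ∧
      cisMassLE cexCodes cexWeights ![0] 0 = 10 ∧ cisMassLE cexCodes cexWeights ![2] 1 = 10 := by
  decide

/-- **The example violates (5.1) for the split `({1},{2})`** (`C = {1}`, `D = {0}`, `x = 0`, `y = ½`). [this work] -/
theorem not_isCMTP2Set_cexLaw : ¬ IsCMTP2Set (cexLaw.map initLast) := by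
  intro h
  have key := h (measurableSet_singleton (codeVal ∘ ![2])) (measurableSet_singleton (codeVal ∘ ![0]))
    (codeVal 0) (codeVal 1)
  have e1 : (codeVal ∘ ![2]) ⊓ (codeVal ∘ ![0]) = codeVal ∘ ![0] := by
    funext i
    fin_cases i
    show codeVal 2 ⊓ codeVal 0 = codeVal 0
    exact inf_eq_right.2 (strictMono_codeVal.monotone (by decide))
  have e2 : (codeVal ∘ ![2]) ⊔ (codeVal ∘ ![0]) = codeVal ∘ ![2] := by
    funext i
    fin_cases i
    show codeVal 2 ⊔ codeVal 0 = codeVal 2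
    exact sup_eq_left.2 (strictMono_codeVal.monotone (by decide))
  have e3 : codeVal 0 ⊓ codeVal 1 = codeVal 0 := inf_eq_left.2 (strictMono_codeVal.monotone (by decide))
  have e4 : codeVal 0 ⊔ codeVal 1 = codeVal 1 := sup_eq_right.2 (strictMono_codeVal.monotone (by decide))
  have hcut : ∀ (t : Fin 3) (v : Fin 3), codeVal v ≤ codeVal t ↔ v ≤ t := fun t v => strictMono_codeVal.le_iff_le
  rw [Set.singleton_infs_singleton, Set.singleton_sups_singleton, e1, e2, e3, e4, cexLaw, Measure.map_smul,
    Measure.smul_apply, Measure.smul_apply, Measure.smul_apply, Measure.smul_apply, smul_eq_mul, smul_eq_mul,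
    smul_eq_mul, smul_eq_mul, map_initLast_codedLaw_prod_Iic strictMono_codeVal _ _ _ (hcut 0),
    map_initLast_codedLaw_prod_Iic strictMono_codeVal _ _ _ (hcut 1),
    map_initLast_codedLaw_prod_Iic strictMono_codeVal _ _ _ (hcut 0),
    map_initLast_codedLaw_prod_Iic strictMono_codeVal _ _ _ (hcut 1)] at key
  obtain ⟨h9, h12, h10, h10'⟩ := cisMassLE_cex
  rw [h9, h12, h10, h10', mul_mul_mul_comm (40:ℝ≥0∞)⁻¹ ((9:ℕ):ℝ≥0∞) (40:ℝ≥0∞)⁻¹ ((12:ℕ):ℝ≥0∞),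
    mul_mul_mul_comm (40:ℝ≥0∞)⁻¹ ((10:ℕ):ℝ≥0∞) (40:ℝ≥0∞)⁻¹ ((10:ℕ):ℝ≥0∞), ← Nat.cast_mul, ← Nat.cast_mul] at key
  have hr0 : (40:ℝ≥0∞)⁻¹ * 40⁻¹ ≠ 0 :=
    mul_ne_zero (ENNReal.inv_ne_zero.2 (by norm_num)) (ENNReal.inv_ne_zero.2 (by norm_num))
  have hrT : (40:ℝ≥0∞)⁻¹ * 40⁻¹ ≠ ∞ :=
    ENNReal.mul_ne_top (ENNReal.inv_ne_top.2 (by norm_num)) (ENNReal.inv_ne_top.2 (by norm_num))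
  have hnat := (ENNReal.mul_le_mul_iff_right hr0 hrT).1 key
  rw [Nat.cast_le] at hnat
  exact absurd hnat (by norm_num)

/-- **CIS ⇏ (5.1)**: there is a probability law on `[0,1]²` that is CIS in the a.e.-kernel sense but violates
Fuchs–Wang's density-free `cMTP₂^set(X₂|X₁)` — the converse of (density-free) Thm. 2.8 (1) fails. [this work] -/
theorem exists_isCISae_not_isCMTP2Set :
    ∃ μ : Measure (Fin 2 → I), IsProbabilityMeasure μ ∧ IsCISae 2 μ ∧ ¬ IsCMTP2Set (μ.map initLast) :=
  ⟨cexLaw, inferInstance, isCISae_cexLaw, not_isCMTP2Set_cexLaw⟩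

end Summit.CriticalPhenomena.PercolationContinuityZ3.Theorems.SahiCMTP2
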